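import Mathlib.Analysis.SpecialFunctions.Log.Basic
import Mathlib.Algebra.Order.Floor.Defs
import Mathlib.Data.Int.Interval
import Mathlib.Data.Fintype.BigOperators
import Mathlib.Data.Nat.Log
import Mathlib.Tactic.IntervalCases
import Literature.NumberTheory.ConnesConsani2023.RiemannRochSpecZ
import HarnessLib

/-!
# Connes–Consani, Riemann–Roch for `Spec ℤ̄` — proof of Proposition 3.3 (i) (the dimension of `‖Hℤ‖_n`)

Discharges the named fact `Literature.NumberTheory.ConnesConsani2023.dim_HZnorm_eq`
(A. Connes, C. Consani, *Riemann–Roch for `\overline{Spec ℤ}`*, Bull. Sci. Math. 187 (2023) 103293 =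
arXiv:2205.01391, Proposition 3.3 (i), p. 7 [bib: `ConnesConsani2023RiemannRoch`]): for every `n ≥ 0`,
`dim_{𝕊[±1]} ‖Hℤ‖_n = ⌈log(2n+1)/log 3⌉`, where the dimension (`pmDim (HZball n) n`, Def. 6.2) is the least
cardinality of `F ⊆ [-n, n] ∩ ℤ` such that every integer `|x| ≤ n` is `Σ_F α_j j` with `α_j ∈ {-1,0,1}` and
`Σ_F |α_j j| ≤ n`.

We FOLLOW THE PRINTED PROOF (pp. 7–9).
* Lower bound (p. 8): "the cardinality of `[-n,n] ∩ ℤ` is `2n+1` and the cardinality of `{-1,0,1}^{#F}` is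
  `3^{#F}`", so a generating set has `3^{#F} ≥ 2n+1` (`two_mul_add_one_le_pow_card`, a counting argument on
  the finite set of signed sums).
* Upper bound: Lemma 3.1 (`signedSumsCover_F3`: the signed sums of `F(m) = {1, 3, …, 3^{m-1}}` are exactly
  `[-(3^m-1)/2, (3^m-1)/2]`, balanced ternary), and the sets of Prop. 3.3 (ii): with `3^m < 2n+1 ≤ 3^{m+1}`,
  `q = (3^m-1)/2`, the generic set is `F(m) ∪ {n - q}` (`caseA`, valid when `n - q ∉ F(m)`, i.e. `n ∉ E`);
  all sets used have `ΣF = n`, which makes the norm condition automatic (`norm_le_sum`), and the covering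
  property propagates through the elementary interval trick "insert `w ≤ 2ΣF + 1`"
  (`signedSumsCover_insert`; the three translates of `[-s, s]` overlap, as in the proofs of Lemma 3.1 and
  Prop. 3.3).  DEVIATION (inessential): for the exceptional `n ∈ E` (`n - q = 3^ℓ`) the paper uses the repair
  sets `{3^k}_{k ≤ m-2} ∪ {2, 3^{m-1} - 1}` (`ℓ = 0`) and a second family for `ℓ > 0`; we use instead the single
  family `F(m-1) ∪ {3^{m-1} - 1, 3^ℓ + 1}` (`caseB`), which has the same cardinality `m + 1` and sum `n` and
  is handled by the same interval trick; the two genuinely special values `n = 2, 5` (where no set with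
  `ΣF = n` works, Prop. 3.3 (ii)) are done by hand with `{1,2}` and `{1,2,3}` exactly as in the paper
  (`special_two`, `special_five`).  The exponent `m` is `Nat.log 3 (2n)`.
* Assembly (`dim_HZnorm_eq_holds`): `2n+1 ≤ 3^d < 3(2n+1)` for `d = pmDim`, hence `⌈log(2n+1)/log 3⌉ = d`
  (`Int.ceil_eq_iff`, monotonicity of `Real.log`).

The combinatorics is done on `Finset ℕ` (`IsSignedSum`, `SignedSumsCover`) and transferred to the real-number
formulation of `RiemannRochSpecZ.lean` by `pmGenerates_image`.
-/

noncomputable section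

open Finset

namespace Literature.NumberTheory.ConnesConsani2023

/-! ## Signed subset sums of finite sets of naturals -/

/-- `x` is a signed sum `Σ_{j ∈ F} α_j j`, `α_j ∈ {-1,0,1}`, of norm `Σ |α_j| j ≤ N`: the representation
required by the generation condition of `‖Hℤ‖_N` (§3 p. 7), for a set `F` of naturals. [cite: ConnesConsani2023RiemannRoch, Prop. 3.3 p. 7] -/
def IsSignedSum (F : Finset ℕ) (N : ℕ) (x : ℤ) : Prop :=
  ∃ α : ℕ → ℤ, (∀ j ∈ F, α j = -1 ∨ α j = 0 ∨ α j = 1) ∧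
    x = ∑ j ∈ F, α j * j ∧ ∑ j ∈ F, |α j| * j ≤ (N : ℤ)

/-- The signed sums of `F` cover the integer interval `[-ΣF, ΣF]` (then the norm bound `ΣF` is automatic):
the property of the sets constructed in the proof of Prop. 3.3. [cite: ConnesConsani2023RiemannRoch, Prop. 3.3 p. 7] -/
def SignedSumsCover (F : Finset ℕ) : Prop :=
  ∀ x : ℤ, |x| ≤ ((∑ j ∈ F, j : ℕ) : ℤ) → IsSignedSum F (∑ j ∈ F, j) x

/-- Signed sums are symmetric under `x ↦ -x` (negate the coefficients). [folklore] -/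
theorem isSignedSum_neg {F : Finset ℕ} {N : ℕ} {x : ℤ} (h : IsSignedSum F N x) :
    IsSignedSum F N (-x) := by
  obtain ⟨α, hα, hx, hN⟩ := h
  refine ⟨fun j => -α j, fun j hj => ?_, ?_, ?_⟩
  · rcases hα j hj with h | h | h <;> simp [h]
  · rw [hx, ← Finset.sum_neg_distrib]
    exact Finset.sum_congr rfl fun j _ => by ring
  · simpa [abs_neg] using hN

/-- Monotonicity of the norm bound. [folklore] -/
theorem isSignedSum_mono {F : Finset ℕ} {N N' : ℕ} {x : ℤ} (h : IsSignedSum F N x) (hN : N ≤ N') :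
    IsSignedSum F N' x := by
  obtain ⟨α, hα, hx, hb⟩ := h
  exact ⟨α, hα, hx, hb.trans (by exact_mod_cast hN)⟩

/-- The norm of any signed sum of `F` is at most `ΣF`. [folklore] -/
theorem norm_le_sum {F : Finset ℕ} {α : ℕ → ℤ} (hα : ∀ j ∈ F, α j = -1 ∨ α j = 0 ∨ α j = 1) :
    ∑ j ∈ F, |α j| * j ≤ ((∑ j ∈ F, j : ℕ) : ℤ) := by
  push_cast
  refine Finset.sum_le_sum fun j hj => ?_
  have : |α j| ≤ 1 := by rcases hα j hj with h | h | h <;> simp [h]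
  nlinarith [Int.natCast_nonneg j]

/-- The empty set covers `[0, 0]`. [folklore] -/
theorem signedSumsCover_empty : SignedSumsCover ∅ := by
  intro x hx
  refine ⟨fun _ => 0, by simp, ?_, by simp⟩
  simp only [Finset.sum_empty, Nat.cast_zero, abs_nonpos_iff] at hx
  simp [hx]

/-- The interval trick of Lemma 3.1 / Prop. 3.3: inserting an element `w ≤ 2 ΣF + 1` keeps the set of
signed sums an interval (the three translates `[-s,s]`, `±w + [-s,s]` overlap). [cite: ConnesConsani2023RiemannRoch, Prop. 3.3 p. 7] -/
theorem signedSumsCover_insert {F : Finset ℕ} {w : ℕ} (hF : SignedSumsCover F) (hw : w ∉ F)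
    (hb : (w : ℤ) ≤ 2 * ((∑ j ∈ F, j : ℕ) : ℤ) + 1) : SignedSumsCover (insert w F) := by
  intro x hx
  have hsum : ((∑ j ∈ insert w F, j : ℕ) : ℤ) = w + ((∑ j ∈ F, j : ℕ) : ℤ) := by
    rw [Finset.sum_insert hw]; push_cast; ring
  rw [hsum] at hx
  set s : ℤ := ((∑ j ∈ F, j : ℕ) : ℤ) with hs
  have hs0 : 0 ≤ s := by positivity
  -- choose the coefficient `ε` of `w` so that `x - ε w ∈ [-s, s]`
  obtain ⟨ε, hε, hy⟩ : ∃ ε : ℤ, (ε = -1 ∨ ε = 0 ∨ ε = 1) ∧ |x - ε * w| ≤ s := by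
    by_cases h0 : |x| ≤ s
    · exact ⟨0, Or.inr (Or.inl rfl), by simpa using h0⟩
    · have h0' : s < |x| := lt_of_not_ge h0
      rcases le_or_gt 0 x with hx0 | hx0
      · refine ⟨1, Or.inr (Or.inr rfl), ?_⟩
        rw [abs_of_nonneg hx0] at hx h0'
        rw [abs_le]; constructor <;> linarith
      · refine ⟨-1, Or.inl rfl, ?_⟩
        rw [abs_of_neg hx0] at hx h0'
        rw [abs_le]; constructor <;> linarith
  obtain ⟨α, hα, hxy, -⟩ := hF (x - ε * w) hy
  refine ⟨Function.update α w ε, ?_, ?_, ?_⟩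
  · intro j hj
    rcases Finset.mem_insert.mp hj with rfl | hj
    · simpa using hε
    · rw [Function.update_of_ne (ne_of_mem_of_not_mem hj hw)]
      exact hα j hj
  · rw [Finset.sum_insert hw, Function.update_self]
    have : ∑ j ∈ F, Function.update α w ε j * (j : ℤ) = ∑ j ∈ F, α j * (j : ℤ) :=
      Finset.sum_congr rfl fun j hj => by rw [Function.update_of_ne (ne_of_mem_of_not_mem hj hw)]
    rw [this, ← hxy]; ring
  · -- the norm bound is automatic: `Σ |α_j| j ≤ Σ j`
    have := norm_le_sum (F := insert w F) (α := Function.update α w ε) ?_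
    · simpa [Finset.sum_insert hw] using this
    · intro j hj
      rcases Finset.mem_insert.mp hj with rfl | hj
      · simpa using hε
      · rw [Function.update_of_ne (ne_of_mem_of_not_mem hj hw)]
        exact hα j hj

/-! ## Powers of `3` -/

/-- `F3 m = {1, 3, …, 3^{m-1}}` — the set `F(m)` of Lemma 3.1. [cite: ConnesConsani2023RiemannRoch, Lemma 3.1 p. 7] -/
def F3 (m : ℕ) : Finset ℕ := (Finset.range m).image (3 ^ ·)

/-- `q3 m = 1 + 3 + ⋯ + 3^{m-1} = (3^m - 1)/2`, the `n` of Lemma 3.1. [cite: ConnesConsani2023RiemannRoch, Lemma 3.1 p. 7] -/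
def q3 (m : ℕ) : ℕ := ∑ i ∈ Finset.range m, 3 ^ i

/-- `2 · q3 m + 1 = 3^m`. [folklore] -/
theorem two_q3_add_one (m : ℕ) : 2 * q3 m + 1 = 3 ^ m := by
  induction m with
  | zero => simp [q3]
  | succ m ih =>
    simp only [q3, Finset.sum_range_succ] at ih ⊢
    rw [pow_succ]
    omega

/-- `i ↦ 3^i` is injective. [folklore] -/
theorem three_pow_injective : Function.Injective (fun i : ℕ => 3 ^ i) :=
  Nat.pow_right_injective (by norm_num)

/-- `#F(m) = m`. [folklore] -/
theorem card_F3 (m : ℕ) : (F3 m).card = m := by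
  rw [F3, Finset.card_image_of_injective _ three_pow_injective, Finset.card_range]

/-- `Σ F(m) = (3^m - 1)/2`. [folklore] -/
theorem sum_F3 (m : ℕ) : ∑ j ∈ F3 m, j = q3 m := by
  rw [F3, Finset.sum_image fun i _ j _ h => three_pow_injective h, q3]

/-- Membership in `F(m)`. [folklore] -/
theorem mem_F3 {m j : ℕ} : j ∈ F3 m ↔ ∃ i < m, 3 ^ i = j := by
  simp [F3]

/-- `3^m ∉ F(m)`. [folklore] -/
theorem pow_not_mem_F3 (m : ℕ) : 3 ^ m ∉ F3 m := by
  rw [mem_F3]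
  rintro ⟨i, hi, h⟩
  exact absurd (three_pow_injective h) (ne_of_lt hi)

/-- `F(m+1) = F(m) ∪ {3^m}`. [folklore] -/
theorem F3_succ (m : ℕ) : F3 (m + 1) = insert (3 ^ m) (F3 m) := by
  rw [F3, F3, Finset.range_add_one, Finset.image_insert]

/-- **Lemma 3.1** (balanced ternary): the signed sums of `F(m) = {3^i : i < m}` cover `[-(3^m-1)/2, (3^m-1)/2]`.
[cite: ConnesConsani2023RiemannRoch, Lemma 3.1 p. 7] -/
theorem signedSumsCover_F3 (m : ℕ) : SignedSumsCover (F3 m) := by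
  induction m with
  | zero => simpa [F3] using signedSumsCover_empty
  | succ m ih =>
    rw [F3_succ]
    refine signedSumsCover_insert ih (pow_not_mem_F3 m) ?_
    rw [sum_F3]
    have := two_q3_add_one m
    zify at this
    push_cast
    linarith

/-- Elements of `F(m)` are `≥ 1`. [folklore] -/
theorem one_le_of_mem_F3 {m j : ℕ} (h : j ∈ F3 m) : 1 ≤ j := by
  obtain ⟨i, -, rfl⟩ := mem_F3.mp h
  exact Nat.one_le_pow _ _ (by norm_num)

/-- Elements of `F(m+1)` are `≤ 3^m`. [folklore] -/
theorem le_of_mem_F3 {m j : ℕ} (h : j ∈ F3 (m + 1)) : j ≤ 3 ^ m := by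
  obtain ⟨i, hi, rfl⟩ := mem_F3.mp h
  exact Nat.pow_le_pow_right (by norm_num) (Nat.lt_succ_iff.mp hi)

/-- Powers of `3` are odd. [folklore] -/
theorem three_pow_mod_two (i : ℕ) : 3 ^ i % 2 = 1 := by
  induction i with
  | zero => rfl
  | succ i ih => rw [pow_succ, Nat.mul_mod, ih]

/-! ## The generating sets of Proposition 3.3 -/

/-- Generic case of the proof of Prop. 3.3 (`n ∉ E`): `F = F(m) ∪ {n - q}`, `q = (3^m-1)/2 < n ≤ (3^{m+1}-1)/2`,
`n - q ∉ F(m)`: covering, `ΣF = n`, `#F = m + 1`, elements positive. [cite: ConnesConsani2023RiemannRoch, Prop. 3.3 p. 7] -/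
theorem caseA {m n : ℕ} (hqn : q3 m < n) (hn : n ≤ 3 * q3 m + 1) (hw : n - q3 m ∉ F3 m) :
    SignedSumsCover (insert (n - q3 m) (F3 m)) ∧ (∑ j ∈ insert (n - q3 m) (F3 m), j) = n ∧
      (insert (n - q3 m) (F3 m)).card = m + 1 ∧ ∀ j ∈ insert (n - q3 m) (F3 m), 1 ≤ j := by
  refine ⟨?_, ?_, ?_, ?_⟩
  · refine signedSumsCover_insert (signedSumsCover_F3 m) hw ?_
    rw [sum_F3]; push_cast [hqn.le]; linarith [show (n : ℤ) ≤ 3 * q3 m + 1 by exact_mod_cast hn]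
  · rw [Finset.sum_insert hw, sum_F3]; omega
  · rw [Finset.card_insert_of_notMem hw, card_F3]
  · intro j hj
    rcases Finset.mem_insert.mp hj with rfl | hj
    · omega
    · exact one_le_of_mem_F3 hj

/-- Exceptional case of the proof of Prop. 3.3 (`n ∈ E`, i.e. `n - q = 3^ℓ ∈ F(m'+1)`), `m' ≥ 1`, `n ≠ 5`:
the set `F(m') ∪ {3^{m'} - 1, n - q + 1}` (a uniform variant of the paper's repair sets; same cardinality
`m' + 2`, sum `n`). [cite: ConnesConsani2023RiemannRoch, Prop. 3.3 p. 7] -/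
theorem caseB {m' n : ℕ} (hm' : 1 ≤ m') (hqn : q3 (m' + 1) < n)
    (hw : n - q3 (m' + 1) ∈ F3 (m' + 1)) (hex : ¬ (m' = 1 ∧ n - q3 (m' + 1) = 1)) :
    let G := insert (n - q3 (m' + 1) + 1) (insert (3 ^ m' - 1) (F3 m'))
    SignedSumsCover G ∧ (∑ j ∈ G, j) = n ∧ G.card = m' + 2 ∧ ∀ j ∈ G, 1 ≤ j := by
  intro G
  set w := n - q3 (m' + 1) with hwdef
  set v := 3 ^ m' - 1 with hvdef
  have hq : q3 (m' + 1) = q3 m' + 3 ^ m' := by simp [q3, Finset.sum_range_succ]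
  have h3m' : 3 ≤ 3 ^ m' := by
    calc 3 = 3 ^ 1 := by norm_num
      _ ≤ 3 ^ m' := Nat.pow_le_pow_right (by norm_num) hm'
  have hq2 := two_q3_add_one m'
  -- `v ∉ F3 m'`: it exceeds every element
  have hv_notMem : v ∉ F3 m' := by
    intro h
    obtain ⟨i, hi, h3⟩ := mem_F3.mp h
    have : 3 ^ i ≤ 3 ^ (m' - 1) := Nat.pow_le_pow_right (by norm_num) (by omega)
    have h' : 3 ^ (m' - 1) * 3 = 3 ^ m' := by
      rw [← pow_succ]; congr 1; omega
    omega
  -- `w = 3^ℓ` with `ℓ ≤ m'`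
  obtain ⟨ℓ, hℓ, hℓw⟩ := mem_F3.mp hw
  have hwle : w ≤ 3 ^ m' := le_of_mem_F3 hw
  have hw1 : 1 ≤ w := one_le_of_mem_F3 hw
  -- `w + 1 ∉ insert v (F3 m')`
  have hu_notMem : w + 1 ∉ insert v (F3 m') := by
    intro h
    rcases Finset.mem_insert.mp h with h | h
    · -- `3^ℓ + 2 = 3^{m'}` forces `ℓ = 0`, `m' = 1`
      apply hex
      rcases Nat.eq_zero_or_pos ℓ with hℓ0 | hℓ0
      · subst hℓ0
        have h3 : 3 ^ m' = 3 ^ 1 := by simp at hℓw; omega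
        exact ⟨Nat.pow_right_injective (by norm_num) h3, by simp at hℓw; omega⟩
      · exfalso
        have h1 : 3 ^ ℓ % 3 = 0 := by
          rw [← Nat.dvd_iff_mod_eq_zero]; exact dvd_pow_self 3 hℓ0.ne'
        have h2 : 3 ^ m' % 3 = 0 := by
          rw [← Nat.dvd_iff_mod_eq_zero]; exact dvd_pow_self 3 (by omega)
        omega
    · -- parity: `3^ℓ + 1` is even, elements of `F3 m'` are odd
      obtain ⟨i, -, hi⟩ := mem_F3.mp h
      have h1 := three_pow_mod_two i
      have h2 := three_pow_mod_two ℓ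
      omega
  have h1le : 1 ≤ 3 ^ m' := le_trans (by norm_num) h3m'
  have hvZ : (v : ℤ) = 3 ^ m' - 1 := by rw [hvdef]; push_cast [h1le]; ring
  have hwZ : (w : ℤ) = n - q3 (m' + 1) := by rw [hwdef]; push_cast [hqn.le]; ring
  have hq2Z : 2 * (q3 m' : ℤ) + 1 = 3 ^ m' := by exact_mod_cast hq2
  have hqZ : (q3 (m' + 1) : ℤ) = q3 m' + 3 ^ m' := by exact_mod_cast hq
  have hwleZ : (w : ℤ) ≤ 3 ^ m' := by exact_mod_cast hwle
  have h3Z : (3 : ℤ) ≤ 3 ^ m' := by exact_mod_cast h3m'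
  refine ⟨?_, ?_, ?_, ?_⟩
  · refine signedSumsCover_insert (signedSumsCover_insert (signedSumsCover_F3 m') hv_notMem ?_)
      hu_notMem ?_
    · rw [sum_F3, hvZ]
      linarith
    · rw [Finset.sum_insert hv_notMem, sum_F3]
      push_cast
      rw [hvZ, hwZ, hqZ]
      linarith
  · rw [Finset.sum_insert hu_notMem, Finset.sum_insert hv_notMem, sum_F3]
    omega
  · rw [Finset.card_insert_of_notMem hu_notMem, Finset.card_insert_of_notMem hv_notMem, card_F3]
  · intro j hj
    rcases Finset.mem_insert.mp hj with rfl | hj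
    · omega
    rcases Finset.mem_insert.mp hj with rfl | hj
    · omega
    · exact one_le_of_mem_F3 hj

/-! ## The two exceptional values `n = 2, 5` and the existence theorem -/

/-- `n = 2` (special value of Prop. 3.3 (ii)): `F = {1, 2}` generates `‖Hℤ‖_2`. [cite: ConnesConsani2023RiemannRoch, Prop. 3.3 p. 7] -/
theorem special_two : ∀ x : ℤ, |x| ≤ 2 → IsSignedSum ({1, 2} : Finset ℕ) 2 x := by
  have h0 : IsSignedSum ({1, 2} : Finset ℕ) 2 0 := ⟨fun _ => 0, by decide, by decide, by decide⟩
  have h1 : IsSignedSum ({1, 2} : Finset ℕ) 2 1 :=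
    ⟨fun j => if j = 1 then 1 else 0, by decide, by decide, by decide⟩
  have h2 : IsSignedSum ({1, 2} : Finset ℕ) 2 2 :=
    ⟨fun j => if j = 2 then 1 else 0, by decide, by decide, by decide⟩
  intro x hx
  obtain ⟨hx1, hx2⟩ := abs_le.mp hx
  interval_cases x
  · simpa using isSignedSum_neg h2
  · simpa using isSignedSum_neg h1
  · exact h0
  · exact h1
  · exact h2

/-- `n = 5` (special value of Prop. 3.3 (ii)): `F = {1, 2, 3}` generates `‖Hℤ‖_5`. [cite: ConnesConsani2023RiemannRoch, Prop. 3.3 p. 7] -/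
theorem special_five : ∀ x : ℤ, |x| ≤ 5 → IsSignedSum ({1, 2, 3} : Finset ℕ) 5 x := by
  have h0 : IsSignedSum ({1, 2, 3} : Finset ℕ) 5 0 := ⟨fun _ => 0, by decide, by decide, by decide⟩
  have h1 : IsSignedSum ({1, 2, 3} : Finset ℕ) 5 1 :=
    ⟨fun j => if j = 1 then 1 else 0, by decide, by decide, by decide⟩
  have h2 : IsSignedSum ({1, 2, 3} : Finset ℕ) 5 2 :=
    ⟨fun j => if j = 2 then 1 else 0, by decide, by decide, by decide⟩
  have h3 : IsSignedSum ({1, 2, 3} : Finset ℕ) 5 3 :=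
    ⟨fun j => if j = 3 then 1 else 0, by decide, by decide, by decide⟩
  have h4 : IsSignedSum ({1, 2, 3} : Finset ℕ) 5 4 :=
    ⟨fun j => if j = 2 then 0 else 1, by decide, by decide, by decide⟩
  have h5 : IsSignedSum ({1, 2, 3} : Finset ℕ) 5 5 :=
    ⟨fun j => if j = 1 then 0 else 1, by decide, by decide, by decide⟩
  intro x hx
  obtain ⟨hx1, hx2⟩ := abs_le.mp hx
  interval_cases x
  · simpa using isSignedSum_neg h5
  · simpa using isSignedSum_neg h4
  · simpa using isSignedSum_neg h3
  · simpa using isSignedSum_neg h2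
  · simpa using isSignedSum_neg h1
  · exact h0
  · exact h1
  · exact h2
  · exact h3
  · exact h4
  · exact h5

/-- From a covering set with `ΣF = n`: representations of norm `≤ n`, and all elements are `≤ n`. [folklore] -/
theorem of_cover {F : Finset ℕ} {n : ℕ} (hcov : SignedSumsCover F) (hsum : (∑ j ∈ F, j) = n)
    (hpos : ∀ j ∈ F, 1 ≤ j) :
    (∀ j ∈ F, 1 ≤ j ∧ j ≤ n) ∧ ∀ x : ℤ, |x| ≤ n → IsSignedSum F n x := by
  refine ⟨fun j hj => ⟨hpos j hj, ?_⟩, fun x hx => ?_⟩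
  · rw [← hsum]
    exact Finset.single_le_sum (fun i _ => Nat.zero_le i) hj
  · rw [← hsum] at hx ⊢
    exact hcov x hx

/-- **Upper bound of Prop. 3.3 (i), combinatorial form.** For every `n` there is a finite set `F` of
integers in `[1, n]` with `3^{#F} < 3(2n+1)` (i.e. `#F ≤ ⌈log₃(2n+1)⌉`) such that every integer `|x| ≤ n`
is a signed sum of `F` of norm `≤ n`. [cite: ConnesConsani2023RiemannRoch, Prop. 3.3 p. 7] -/
theorem exists_generating_nat (n : ℕ) :
    ∃ F : Finset ℕ, (∀ j ∈ F, 1 ≤ j ∧ j ≤ n) ∧ 3 ^ F.card < 3 * (2 * n + 1) ∧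
      ∀ x : ℤ, |x| ≤ n → IsSignedSum F n x := by
  rcases Nat.eq_zero_or_pos n with rfl | hn
  · refine ⟨∅, by simp, by simp, fun x hx => ?_⟩
    simpa using signedSumsCover_empty x (by simpa using hx)
  -- `m` with `3^m ≤ 2n < 3^{m+1}`
  obtain ⟨m, hm1, hm2⟩ : ∃ m : ℕ, 3 ^ m ≤ 2 * n ∧ 2 * n < 3 ^ (m + 1) :=
    ⟨Nat.log 3 (2 * n), Nat.pow_log_le_self 3 (by omega), Nat.lt_pow_succ_log_self (by norm_num) _⟩
  have hq := two_q3_add_one m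
  have hq' := two_q3_add_one (m + 1)
  have hqn : q3 m < n := by omega
  have hn3 : n ≤ 3 * q3 m + 1 := by rw [pow_succ] at hm2; omega
  by_cases hw : n - q3 m ∈ F3 m
  · -- case B or the exceptional values
    obtain ⟨m', rfl⟩ : ∃ m', m = m' + 1 := by
      rcases Nat.eq_zero_or_pos m with h0 | h0
      · rw [h0] at hw; simp [F3] at hw
      · exact ⟨m - 1, by omega⟩
    by_cases hspecial : m' = 0 ∨ (m' = 1 ∧ n - q3 (m' + 1) = 1)
    · rcases hspecial with rfl | ⟨rfl, h51⟩
      · -- `m = 1`: `q = 1`, `n - 1 ∈ {1}`, so `n = 2`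
        have hq1 : q3 1 = 1 := by decide
        have hF31 : F3 1 = {1} := by decide
        rw [zero_add, hq1, hF31, Finset.mem_singleton] at hw
        have hn2 : n = 2 := by omega
        subst hn2
        exact ⟨{1, 2}, by decide, by decide, special_two⟩
      · -- `m = 2`: `q = 4`, `n = 5`
        have hq2 : q3 2 = 4 := by decide
        have hn5 : n = 5 := by rw [hq2] at h51; omega
        subst hn5
        exact ⟨{1, 2, 3}, by decide, by decide, special_five⟩
    · have hm' : 1 ≤ m' := by omega
      have hex : ¬ (m' = 1 ∧ n - q3 (m' + 1) = 1) := fun h => hspecial (Or.inr h)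
      obtain ⟨hcov, hsum, hcard, hpos⟩ := caseB hm' hqn hw hex
      obtain ⟨hle, hrep⟩ := of_cover hcov hsum hpos
      refine ⟨_, hle, ?_, hrep⟩
      rw [hcard, show m' + 2 = (m' + 1) + 1 by ring, pow_succ]
      omega
  · obtain ⟨hcov, hsum, hcard, hpos⟩ := caseA hqn hn3 hw
    obtain ⟨hle, hrep⟩ := of_cover hcov hsum hpos
    refine ⟨_, hle, ?_, hrep⟩
    rw [hcard, pow_succ]
    omega

/-! ## Transfer to `PmGenerates` over `ℝ` and the lower bound -/

/-- A set of naturals as in `exists_generating_nat` generates `‖Hℤ‖_n` in the sense of Def. 6.2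
(`PmGenerates (HZball n) n`). [cite: ConnesConsani2023RiemannRoch, Prop. 3.3 p. 7] -/
theorem pmGenerates_image {n : ℕ} {F : Finset ℕ} (hF : ∀ j ∈ F, 1 ≤ j ∧ j ≤ n)
    (hrep : ∀ x : ℤ, |x| ≤ n → IsSignedSum F n x) :
    PmGenerates (HZball n) (n : ℝ) (F.image fun j : ℕ => (j : ℝ)) := by
  classical
  refine ⟨?_, ?_⟩
  · intro y hy
    obtain ⟨j, hj, rfl⟩ := Finset.mem_image.mp (Finset.mem_coe.mp hy)
    refine ⟨⟨(j : ℤ), by push_cast; rfl⟩, ?_⟩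
    rw [Nat.abs_cast]
    exact_mod_cast (hF j hj).2
  · rintro x ⟨⟨k, rfl⟩, hk⟩
    have hk' : |k| ≤ (n : ℤ) := by
      rw [← Int.cast_abs] at hk
      exact_mod_cast hk
    obtain ⟨α, hα, hx, hN⟩ := hrep k hk'
    refine ⟨fun y => α ⌊y⌋₊, ?_, ?_, ?_⟩
    · intro y hy
      obtain ⟨j, hj, rfl⟩ := Finset.mem_image.mp hy
      simp only [Nat.floor_natCast]
      exact hα j hj
    · rw [Finset.sum_image fun a _ b _ h => Nat.cast_injective (R := ℝ) h]
      simp only [Nat.floor_natCast]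
      rw [hx]
      push_cast
      rfl
    · rw [Finset.sum_image fun a _ b _ h => Nat.cast_injective (R := ℝ) h]
      simp only [Nat.floor_natCast]
      have : ∀ j ∈ F, |((α j : ℤ) : ℝ) * (j : ℝ)| = ((|α j| * (j : ℤ) : ℤ) : ℝ) := by
        intro j _
        push_cast
        rw [abs_mul, Nat.abs_cast]
      rw [Finset.sum_congr rfl this]
      exact_mod_cast hN

/-- **Lower bound of Prop. 3.3 (i)** ("the cardinality of `[-n,n] ∩ ℤ` is `2n+1` and the cardinality of
`{-1,0,1}^{#F}` is `3^{#F}`", p. 8): a generating set of `‖Hℤ‖_n` has `2n + 1 ≤ 3^{#F}`. [cite: ConnesConsani2023RiemannRoch, Prop. 3.3 p. 7] -/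
theorem two_mul_add_one_le_pow_card {n : ℕ} {F : Finset ℝ} (hF : PmGenerates (HZball n) (n : ℝ) F) :
    2 * n + 1 ≤ 3 ^ F.card := by
  classical
  let D : Finset ℤ := {-1, 0, 1}
  let Φ : (↥F → ℤ) → ℝ := fun β => ∑ j ∈ F.attach, (β j : ℝ) * (j : ℝ)
  let T : Finset ℝ := (Fintype.piFinset fun _ : ↥F => D).image Φ
  have hT : T.card ≤ 3 ^ F.card := by
    refine Finset.card_image_le.trans ?_
    rw [Fintype.card_piFinset, Finset.prod_const, Finset.card_univ, Fintype.card_coe]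
    have hD : D.card = 3 := by decide
    rw [hD]
  let C : Finset ℝ := (Finset.Icc (-(n : ℤ)) n).image fun k : ℤ => (k : ℝ)
  have hC : C.card = 2 * n + 1 := by
    rw [Finset.card_image_of_injective _ Int.cast_injective, Int.card_Icc]
    omega
  have hCT : C ⊆ T := by
    intro x hx
    obtain ⟨k, hk, rfl⟩ := Finset.mem_image.mp hx
    rw [Finset.mem_Icc] at hk
    have hkE : ((k : ℤ) : ℝ) ∈ HZball n := by
      refine ⟨⟨k, rfl⟩, ?_⟩
      rw [← Int.cast_abs]
      exact_mod_cast abs_le.mpr ⟨hk.1, hk.2⟩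
    obtain ⟨α, hα, hsum, -⟩ := hF.2 _ hkE
    refine Finset.mem_image.mpr ⟨fun j => α j, ?_, ?_⟩
    · rw [Fintype.mem_piFinset]
      intro j
      rcases hα j j.2 with h | h | h <;> simp [D, h]
    · rw [hsum]
      exact Finset.sum_attach F fun j => ((α j : ℤ) : ℝ) * j
  calc 2 * n + 1 = C.card := hC.symm
    _ ≤ T.card := Finset.card_le_card hCT
    _ ≤ 3 ^ F.card := hT

/-! ## Assembly -/

/-- **Prop. 3.3 (i) of Connes–Consani 2023, PROVED** (discharges the named fact `dim_HZnorm_eq`):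
`dim_{𝕊[±1]} ‖Hℤ‖_n = ⌈log(2n+1)/log 3⌉` for every `n ≥ 0`. [cite: ConnesConsani2023RiemannRoch, Prop. 3.3 p. 7] -/
theorem dim_HZnorm_eq_holds : dim_HZnorm_eq := by
  intro n
  classical
  obtain ⟨F, hF, hcard, hrep⟩ := exists_generating_nat n
  have hgen := pmGenerates_image hF hrep
  set d := pmDim (HZball n) n with hd
  have hmem : ∃ G : Finset ℝ, G.card = d ∧ PmGenerates (HZball n) n G :=
    Nat.sInf_mem (s := {k : ℕ | ∃ G : Finset ℝ, G.card = k ∧ PmGenerates (HZball n) n G})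
      ⟨_, _, rfl, hgen⟩
  obtain ⟨G, hGcard, hG⟩ := hmem
  have h_le : d ≤ F.card := by
    have h := Nat.sInf_le (s := {k : ℕ | ∃ G : Finset ℝ, G.card = k ∧ PmGenerates (HZball n) n G})
      ⟨_, rfl, hgen⟩
    rwa [Finset.card_image_of_injective _ Nat.cast_injective] at h
  have hup : 3 ^ d < 3 * (2 * n + 1) :=
    lt_of_le_of_lt (Nat.pow_le_pow_right (by norm_num) h_le) hcard
  have hlow : 2 * n + 1 ≤ 3 ^ d := hGcard ▸ two_mul_add_one_le_pow_card hG
  have hlog3 : 0 < Real.log 3 := Real.log_pos (by norm_num)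
  have hpos : (0 : ℝ) < 2 * n + 1 := by positivity
  symm
  rw [Int.ceil_eq_iff]
  push_cast
  constructor
  · rw [lt_div_iff₀ hlog3]
    have h1 : (3 : ℝ) ^ d / 3 < 2 * n + 1 := by
      rw [div_lt_iff₀ (by norm_num : (0:ℝ) < 3)]
      exact_mod_cast (show 3 ^ d < (2 * n + 1) * 3 by linarith)
    have h2 := Real.log_lt_log (by positivity) h1
    rw [Real.log_div (by positivity) (by norm_num), Real.log_pow] at h2
    linarith
  · rw [div_le_iff₀ hlog3]
    have h1 : (2 * n + 1 : ℝ) ≤ (3 : ℝ) ^ d := by exact_mod_cast hlow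
    have h2 := Real.log_le_log hpos h1
    rw [Real.log_pow] at h2
    linarith

end Literature.NumberTheory.ConnesConsani2023

end
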